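import Summits.BirchSwinnertonDyer.BirchSwinnertonDyer.Theorems.PrintX11aNonSurjEulerHalfOfMu
import Summits.BirchSwinnertonDyer.BirchSwinnertonDyer.Theorems.PrintX11aNonSurjMuAnHardDefs
import Summits.BirchSwinnertonDyer.BirchSwinnertonDyer.Theorems.PrintX11aUpperNonSurjFiveOrbitUnitOfMultTeichSpan
import Summits.BirchSwinnertonDyer.BirchSwinnertonDyer.Theorems.PrintX11aUpperNonSurjFiveMuAnOfOrbitUnit
import Summits.BirchSwinnertonDyer.Rank1Residual.GaloisImage.MultiplicativeLargeImage
import Summits.BirchSwinnertonDyer.BirchSwinnertonDyer.Theses.PrintX11a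
import Summits.BirchSwinnertonDyer.BirchSwinnertonDyer.Theses.ErratumRoadFive
import HarnessLib

/-!
# Crux U5 `PrintX11a.UpperNonSurjFive` (item stmt-BirchSwinnertonDyer-20614) — THE μ-ROAD REDUCTION AS TREE THEOREMS:
# U5 ⟸ B⁰ at multiplicative levels `5M` and `7M` (pure group theory) + Balakrishnan et al. 2019 + the K2 bundle (19949)

Seat `bsd-line-x11a-p3` g2 (LEAD of crux 20614), `--supports stmt-BirchSwinnertonDyer-20614 --as helper`.  Theorems only (no
definition, no named fact, no `sorry`); every open input is DISPLAYED as a hypothesis; closes nothing.  This is the composition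
of the registered skeleton r3 of line finemu5 ⊕ multteich5 (`Cruxes/UpperNonSurjFive/Lines/finemu5.lean`, evidence 66498ac0) with
its two landed stubs S2 (`orbitUnitAt_of_multTeichSpanGen`, p612440/p614185) and S3 (`stub_multMuAn_of_orbitUnit`, p613261) in the
kernel and its open stubs turned into hypotheses, so that the reduction is CITABLE from the tree:

* `le_seven_of_classX11a_of_not_surj` — VACUITY beyond `p = 7`: an X11a pair with `ρ̄_{E,p}` not surjective has `p ≤ 7`
  (`GaloisImage.eq_five_or_eq_seven_of_mult_of_irr_of_not_surj`, modulo Balakrishnan–Dogra–Müller–Tuitman–Vonk 2019 Thm. 1.2 `hB`).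
* `multTeichSpanGen_of_classX11a_of_not_surj` — dispatch: on the U5 domain the span hypothesis at the prime of the pair is B⁰ at
  multiplicative level `5` or `7` (`h5`, `h7`).
* `multTeichOrbitUnitAt_of_classX11a_of_not_surj` — S2: hence a unit Teichmüller orbit sum at every U5 pair.
* `x11aNonSurjMuAnHardFive_of_multTeichSpan` — S3: hence the registered hard-locus μ-certificate `Theorems.X11aNonSurjMuAnHardFive`
  of the earlier lines «hardlocus5»/«finemu5» (its hard-locus disjunction is not needed).
* `upperNonSurjFive_of_multTeichSpan` — **U5 BY NAME from `h5 ∧ h7 ∧ hB ∧ KatoTwinFactsFiveAn`** (the μ-kernel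
  `multDivisibilityAt_of_katoFacts_of_muAn` and the door `missingUpperBoundAt_of_classX11a_of_multDivisibilityAt`, both landed).
* `upperNonSurjFive_of_multTeichOrbitUnitAt` — the orbit-unit FALLBACK: any supplier of unit orbit sums on U5 closes U5 (with 19949).

HONEST FRAMING: `h5`/`h7` (`MultTeichSpanGen M 5/7` for all `M` prime to `5/7`) are OPEN statements of elementary group theory
(the ideator's census: 23/23 levels); `hB` is a published theorem not proved in the tree; `KatoTwinFactsFiveAn` is the route's
displayed fact bundle (item 19949).  U5 does NOT close; BSD is not proved by any of this.  beyond-print theorem: no.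
References: [Manin1972] Prop. 1.4, Thm. 1.9; [MazurTateTeitelbaum1986Invent] §I.10–I.13; [BalakrishnanEtAl2019] Thm. 1.2;
[Kato2004Asterisque] §17.13 (pp. 279–280); [SteinWuthrich2013] Thm. 6.1; [Mazur1978] Cor. 4.1.
-/

set_option autoImplicit false

noncomputable section

open scoped Classical NumberField MatrixGroups ModularForm
open CongruenceSubgroup WeierstrassCurve Field
open Literature.NumberTheory.EllipticCurves Literature.NumberTheory.EllipticCurves.ModularForms
open Literature.NumberTheory.EllipticCurves.Kato2004 Literature.NumberTheory.EllipticCurves.BalakrishnanEtAl2019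
open Literature.NumberTheory.EllipticCurves.Rank1Residual Literature.NumberTheory.EllipticCurves.Rank1Residual.Typed
open Literature.NumberTheory.EllipticCurves.Wuthrich2014 Literature.NumberTheory.EllipticCurves.SteinWuthrich2013
open Literature.NumberTheory.EllipticCurves.Greenberg1999

-- the summit and its single problem are both named `BirchSwinnertonDyer` (registry layout D-0017)
set_option linter.dupNamespace false

namespace Summit.BirchSwinnertonDyer.BirchSwinnertonDyer.Theorems

open Summit.BirchSwinnertonDyer.Rank1Residual Summit.BirchSwinnertonDyer.Rank1Residual.X11b
  Summit.BirchSwinnertonDyer.BirchSwinnertonDyer.Cruxes.UpperNonSurjFive.MultTeich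

/-- **Vacuity beyond `p = 7`**: an X11a pair with `ρ̄_{E,p}` NOT surjective has `p ≤ 7` — at a multiplicative `p ≥ 5`,
`Irr ∧ ¬Surj` forces `p ∈ {5,7}` (`GaloisImage.eq_five_or_eq_seven_of_mult_of_irr_of_not_surj`, modulo Balakrishnan et al. 2019
Thm. 1.2 = `hB`); `p < 5` is trivial. CONDITIONAL on `hB`. [cite: BalakrishnanEtAl2019, §1 Thm. 1.2 (arXiv:1711.05846 p. 2)] -/
theorem le_seven_of_classX11a_of_not_surj (hB : thm12_not_le_normalizer_splitCartan)
    (W : WeierstrassCurve ℚ) [W.IsElliptic] [W.IsGloballyMinimal] (p : ℕ) [Fact p.Prime]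
    (hX : ClassX11a W p) (hns : ¬ Surj W p) : p ≤ 7 := by
  by_cases h5 : 5 ≤ p
  · rcases GaloisImage.eq_five_or_eq_seven_of_mult_of_irr_of_not_surj W p hB h5 hX.2.2.1 hX.2.2.2.1 hns with h | h <;>
      omega
  · omega

/-- **Dispatch**: on the U5 domain (`5 ≤ p`), B⁰ at the multiplicative levels `5M` (`h5`) and `7M` (`h7`) supply the span
hypothesis `MultTeichSpanGen M p` at the prime `p` of the pair (`p = 6` is not prime). CONDITIONAL on `hB`, `h5`, `h7`.
[cite: Manin1972, Prop. 1.4] [cite: BalakrishnanEtAl2019, §1 Thm. 1.2] -/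
theorem multTeichSpanGen_of_classX11a_of_not_surj (hB : thm12_not_le_normalizer_splitCartan)
    (h5 : ∀ M : ℕ, ¬ 5 ∣ M → MultTeichSpanGen M 5) (h7 : ∀ M : ℕ, ¬ 7 ∣ M → MultTeichSpanGen M 7)
    (W : WeierstrassCurve ℚ) [W.IsElliptic] [W.IsGloballyMinimal] (p : ℕ) [Fact p.Prime]
    (hX : ClassX11a W p) (hns : ¬ Surj W p) (hp5 : 5 ≤ p) : ∀ M : ℕ, ¬ p ∣ M → MultTeichSpanGen M p := by
  have hp : p.Prime := Fact.out
  have hle := le_seven_of_classX11a_of_not_surj hB W p hX hns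
  intro M hM
  interval_cases p
  · exact h5 M hM
  · exact absurd hp (by decide)
  · exact h7 M hM

/-- **S2 on the class**: B⁰ at multiplicative levels `5M`/`7M` ⟹ a unit Teichmüller orbit sum at every X11a pair with `ρ̄` not
surjective and `p ≥ 5` (`MultTeichOrbitUnitAt W p`), by the landed pointwise S2 `orbitUnitAt_of_multTeichSpanGen`.
CONDITIONAL on `hB`, `h5`, `h7`. [cite: Manin1972, Prop. 1.4 and Thm. 1.9] [cite: MazurTateTeitelbaum1986Invent, §I.10 (10.1)] -/
theorem multTeichOrbitUnitAt_of_classX11a_of_not_surj (hB : thm12_not_le_normalizer_splitCartan)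
    (h5 : ∀ M : ℕ, ¬ 5 ∣ M → MultTeichSpanGen M 5) (h7 : ∀ M : ℕ, ¬ 7 ∣ M → MultTeichSpanGen M 7)
    (W : WeierstrassCurve ℚ) [W.IsElliptic] [W.IsGloballyMinimal] (p : ℕ) [Fact p.Prime]
    (hX : ClassX11a W p) (hns : ¬ Surj W p) (hp5 : 5 ≤ p) : MultTeichOrbitUnitAt W p :=
  orbitUnitAt_of_multTeichSpanGen W p hX.2.1 (multTeichSpanGen_of_classX11a_of_not_surj hB h5 h7 W p hX hns hp5)
    hX.2.2.1 hX.2.2.2.1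

/-- **S3 on the class: the hard-locus μ-certificate of the earlier lines is DERIVED** — B⁰ at multiplicative levels `5M`/`7M`,
Balakrishnan et al., Mazur's Manin-constant fact and Wuthrich Cor. 18 give `Theorems.X11aNonSurjMuAnHardFive` (the registered
μ-stub of «hardlocus5»/«finemu5» r1; its hard-locus disjunction is not used). CONDITIONAL; closes nothing.
[cite: MazurTateTeitelbaum1986Invent, §I.10–I.13] [cite: Mazur1978, Cor. 4.1] [cite: GreenbergLNM1716, Conj. 1.11] -/
theorem x11aNonSurjMuAnHardFive_of_multTeichSpan (hB : thm12_not_le_normalizer_splitCartan)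
    (h5 : ∀ M : ℕ, ¬ 5 ∣ M → MultTeichSpanGen M 5) (h7 : ∀ M : ℕ, ¬ 7 ∣ M → MultTeichSpanGen M 7)
    (hM : mazur_not_dvd_maninConstant_of_odd)
    (h18 : Wuthrich2014.corollary18_padicLFunction_mem_iwasawaAlgebra_multiplicative) : X11aNonSurjMuAnHardFive := by
  intro W _ _ p _ hX hns hp5 _hhard N _ f hf ϖ hϖ a L ha1 ha2 hL
  exact stub_multMuAn_of_orbitUnit hM h18 W p hp5 hX.2.2.1 hX.2.2.2.1
    (multTeichOrbitUnitAt_of_classX11a_of_not_surj hB h5 h7 W p hX hns hp5) f hf ϖ hϖ a L ha1 ha2 hL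

/-- **The orbit-unit FALLBACK closes U5 (with 19949)**: any supplier of unit Teichmüller orbit sums on the U5 domain gives the crux
`Theses.PrintX11a.UpperNonSurjFive` BY NAME — S3, the landed μ-kernel `multDivisibilityAt_of_katoFacts_of_muAn` and the door
`missingUpperBoundAt_of_classX11a_of_multDivisibilityAt`, fed the K2 bundle `KatoTwinFactsFiveAn`. CONDITIONAL; closes nothing.
[cite: Kato2004Asterisque, §17.13 (pp. 279–280)] [cite: SteinWuthrich2013, Thm. 6.1 (p. 20)] [cite: MazurTateTeitelbaum1986Invent, §I.10–I.13] -/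
theorem upperNonSurjFive_of_multTeichOrbitUnitAt (hF : Theses.ErratumRoadFive.KatoTwinFactsFiveAn)
    (h : ∀ (W : WeierstrassCurve ℚ) [W.IsElliptic] [W.IsGloballyMinimal] (p : ℕ) [Fact p.Prime],
      ClassX11a W p → ¬ Surj W p → 5 ≤ p → MultTeichOrbitUnitAt W p) :
    Theses.PrintX11a.UpperNonSurjFive := by
  obtain ⟨-, -, -, hGZK, hmod, -, hpar, -, hM, -, -, hJs, hJn, hGS, -, -, hne, h12, hnsI, hspI, h15, h18,
    hfine⟩ := hF
  intro W _ _ p _ hX hns hp5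
  have hμ : MultMuAnAt W p :=
    stub_multMuAn_of_orbitUnit hM h18 W p hp5 hX.2.2.1 hX.2.2.2.1 (h W p hX hns hp5)
  exact missingUpperBoundAt_of_classX11a_of_multDivisibilityAt hJs hJn hGZK hmod hpar W p (hGS W p) hX
    (multDivisibilityAt_of_katoFacts_of_muAn hne h12 hnsI hspI h15 h18 hfine W p hX.2.1 hX.2.2.1 hX.2.2.2.1 hns
      (fun f hf => hμ f hf))

/-- **U5 BY NAME ⟸ B⁰ at multiplicative levels `5M` and `7M` + Balakrishnan et al. 2019 + the K2 bundle** — the μ-road of the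
registered line finemu5 ⊕ multteich5 with its landed stubs S2/S3 in the kernel and its open inputs displayed:
`h5 → h7 → hB → KatoTwinFactsFiveAn → Theses.PrintX11a.UpperNonSurjFive`.  CONDITIONAL; U5 does not close (h5/h7 OPEN).
[cite: Manin1972, Prop. 1.4, Thm. 1.9] [cite: MazurTateTeitelbaum1986Invent, §I.10–I.13] [cite: BalakrishnanEtAl2019, §1 Thm. 1.2]
[cite: Kato2004Asterisque, §17.13 (pp. 279–280)] -/
theorem upperNonSurjFive_of_multTeichSpan (h5 : ∀ M : ℕ, ¬ 5 ∣ M → MultTeichSpanGen M 5)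
    (h7 : ∀ M : ℕ, ¬ 7 ∣ M → MultTeichSpanGen M 7) (hB : thm12_not_le_normalizer_splitCartan)
    (hF : Theses.ErratumRoadFive.KatoTwinFactsFiveAn) : Theses.PrintX11a.UpperNonSurjFive :=
  upperNonSurjFive_of_multTeichOrbitUnitAt hF
    (fun W _ _ p _ hX hns hp5 => multTeichOrbitUnitAt_of_classX11a_of_not_surj hB h5 h7 W p hX hns hp5)

end Summit.BirchSwinnertonDyer.BirchSwinnertonDyer.Theorems

end
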